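import Summits.BirchSwinnertonDyer.BirchSwinnertonDyer.Theorems.EisensteinPrimesAcTwistDeformationCurveCotorsion
import HarnessLib

/-!
# Route `EisensteinPrimes` (rung K5), crux 2 `GoodLatticeBDPValue`, line `halves` v20: the two corank-0
# TRANSPORTS at an ARBITRARY imprimitivity set `S₀` — `corank_Λ S_{𝓛_v}(K, 𝐃) = 0` from a finitely
# generated torsion dual of `H¹_{𝓕_nr^{S₀}}(K_∞, M)` (characters) resp. of `Sel^{S₀}_v̄(K_∞, E[p^∞])`
# (curve) (helper for stmt-BirchSwinnertonDyer-19032)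

Cell `bsd-eis` (home `run/shared/lean/pub/bsd-eis/`), seat `bsd-line-x1-p1-w3` gen 3 (D-0154 width seat
on crux 2 `GoodLatticeBDPValue`). WHY: the v20 skeleton's kernel glue `imprimLambdaT_of_index`
(LEAD g4, `HOME/line-x1-p1-g4/GoodLatticeBDPValue.v20.lean` l.402–449) holds the cotorsion facts of the
composition in the `S₀ = Sf`-IMPRIMITIVE, SPECIFIC-DATUM currency (`hfgS htorS : Module.Finite/IsTorsion
(XAc (W.baseChange K) p κ v̄ ↑Sf γ)`, `hfgSsub htorSsub : Module.Finite/IsTorsion DSsub.X` for ONE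
`DSsub : DatumDualData κ γ (charModule ∅ θsub) (bdpData …) ↑Sf`), whereas the landed transports
(LEAD g2's `hasCorank_fullAtSelmer_zero_of_datumDualData`; the seat's
`hasCorank_fullAtSelmer_zero_of_xAc`, p646196) are stated at `S₀ = ∅`. Since the Shapiro descent of a
class of `S_{𝓛_v}(K, 𝐃)` lands in the `∅`-group, and `H¹_{𝓕_nr^∅} ≤ H¹_{𝓕_nr^{S₀}}`
(`unrSelmer_mono`) resp. `selmerAc … ∅ ≤ selmerAc … S₀` (the `S₀`-conditions are a subset of the
`∅`-conditions), the SAME proofs give the transports from the bigger `S₀`-imprimitive duals: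

* `hasCorank_fullAtSelmer_zero_of_datumDualData_at` — generic discrete `p`-primary `M` with open
  stabilisers, model `ψ : A ≃+ M`, `p = v v̄` the places above `p`: a finitely generated torsion
  `D : DatumDualData κ γ M (bdpData M p v̄) S₀` gives `corank_Λ S_{𝓛_v}(K, 𝐃) = 0` and cofinite generation;
* `hasCorank_fullAtSelmer_zero_of_xAc_at` — `W/K` elliptic, `K` totally complex, `v ≠ v̄` above `p`,
  `S ⊇ {w ∣ p}` with good reduction off `S ∪ {w ∣ p}`: `Module.Finite ∧ IsTorsion (XAc W p κ v̄ S₀ γ)`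
  gives the same for `𝐃_E`.

Theorems only; unconditional; no definition, no named fact, no `sorry`. HONEST FRAMING: closes nothing
by itself (`--supports`); no summit statement / BSD / IMC2 / KY Thm. 1.4.1 (iii) is proved by this file;
0 stubs / cells / labels move. References: [Greenberg2006] Thm. 3 p. 342; [GreenbergVatsal2000] §2
pp. 17, 20 (`S_A ⊆ S^{Σ₀}_A`); [KellerYin2024] §1.2 Def. (3)–(4), Rem. 1.2.3 (arXiv:2402.12781v2);
[Castella2018] §2.2 Def. 2.2; [GreenbergLNM1716] §1 p. 60, Lemma 3.3.
-/

set_option autoImplicit false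
set_option linter.dupNamespace false

noncomputable section

open scoped Classical
open NumberField IsDedekindDomain Field Multiplicative PowerSeries
open Literature.NumberTheory.EllipticCurves Literature.NumberTheory.EllipticCurves.GreenbergSelmer
  Literature.NumberTheory.EllipticCurves.GreenbergVatsal2000 Literature.NumberTheory.GaloisRepresentations
  Literature.NumberTheory.EllipticCurves.KellerYin2024 Literature.NumberTheory.EllipticCurves.IwasawaDual
  Literature.NumberTheory.EllipticCurves.Castella2018.AcSelmer
  Literature.NumberTheory.IwasawaTheory Literature.NumberTheory.IwasawaTheory.Greenberg2016
  Literature.NumberTheory.IwasawaTheory.Greenberg2006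
  Summit.BirchSwinnertonDyer.BirchSwinnertonDyer.Theorems.GreenbergFullAtSelmer
  Summit.BirchSwinnertonDyer.BirchSwinnertonDyer.Theorems.UnrSelmerImprimitiveFiniteness
  Summit.BirchSwinnertonDyer.BirchSwinnertonDyer.Theorems.TwistDeformationCofree

namespace Summit.BirchSwinnertonDyer.BirchSwinnertonDyer.Theorems.AcTwistDeformation

/-! ## §1 Characters / generic `M`: the [RH]-transport at `S₀` -/

section TransportAt

variable {K : Type} [Field K] [NumberField K] (S : Set (HeightOneSpectrum (𝓞 K))) {p : ℕ} [Fact p.Prime]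
  {A : Type} [AddCommGroup A] [Module ℤ_[p] A] [TopologicalSpace A] [DiscreteTopology A]
  [TopologicalSpace (PowerSeries ℤ_[p])] [IsTopologicalRing (PowerSeries ℤ_[p])]
  [IsTopologicalAddGroup (BigRepModule ℤ_[p] p A)] [ContinuousSMul (PowerSeries ℤ_[p]) (BigRepModule ℤ_[p] p A)]
  (hS : ∀ v : HeightOneSpectrum (𝓞 K), ((p : ℕ) : 𝓞 K) ∈ v.asIdeal → v ∈ S)
  (κ : ZpExtension K p) (ρ₀ : ContinuousRep (GaloisGroupUnramifiedOutside K S) ℤ_[p] A)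
  {M : Type} [AddCommGroup M] [DistribMulAction (absoluteGaloisGroup K) M] [TopologicalSpace M]
  [DiscreteTopology M]
  (ψ : A ≃+ M) (hψ : ∀ (σ : absoluteGaloisGroup K) (a : A), ψ (ρ₀ (toUnramifiedQuot K S σ) a) = σ • ψ a)

include hψ in
/-- **The [RH]-transport AT `S₀`: `corank_Λ S_{𝓛_v}(K, 𝐃) = 0` and cofinite generation from a finitely
generated torsion `Λ`-dual datum of the `S₀`-IMPRIMITIVE `H¹_{𝓕_nr^{S₀}}(K_∞, M)`** (any `S₀`; the case
`S₀ = ∅` is LEAD g2's `hasCorank_fullAtSelmer_zero_of_datumDualData`, whose proof this is, composed with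
`unrSelmer_mono ∅ ⊆ S₀`). Data: `M` discrete `p`-primary with open stabilisers, `ψ : A ≃+ M` a model of
`ρ₀`, `γ` a topological generator of `κ`, `p = v v̄` the only places above `p`.
[cite: KellerYin2024, Thm. 1.2.2 and Rem. 1.2.3 (ii) (arXiv:2402.12781v2 TeX L676–712)]
[cite: Greenberg2006, Thm. 3 p. 342 ("as Λ-modules")] [cite: GreenbergVatsal2000, §2 p. 20 ("S_A ⊆ S^{Σ₀}_A")] -/
theorem hasCorank_fullAtSelmer_zero_of_datumDualData_at (S₀ : Set (HeightOneSpectrum (𝓞 K)))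
    (hA : ∀ a : A, ∃ k : ℕ, p ^ k • a = 0)
    (hMtor : ∀ m : M, ∃ k : ℕ, p ^ k • m = 0)
    (hMstab : ∀ m : M, IsOpen (MulAction.stabilizer (absoluteGaloisGroup K) m : Set (absoluteGaloisGroup K)))
    {γ : absoluteGaloisGroup K} (hγ : κ.IsTopGenerator γ)
    {v vbar : HeightOneSpectrum (𝓞 K)} (hv : ((p : ℕ) : 𝓞 K) ∈ v.asIdeal) (hne : vbar ≠ v)
    (hSp : ∀ w : HeightOneSpectrum (𝓞 K), ((p : ℕ) : 𝓞 K) ∈ w.asIdeal → w = v ∨ w = vbar)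
    (D : DatumDualData κ γ M (Castella2018.AcSelmer.bdpData M p vbar) S₀)
    (hDfin : Module.Finite (IwasawaAlgebra p) D.X) (hDtor : Module.IsTorsion (IwasawaAlgebra p) D.X) :
    HasCorank (PowerSeries ℤ_[p])
        (fullAtSpecification S (bigRep (κ.liftUnramifiedOutside S hS) ρ₀) (Sum.inr v)).selmer 0 ∧
      IsCofinitelyGenerated (PowerSeries ℤ_[p])
        (fullAtSpecification S (bigRep (κ.liftUnramifiedOutside S hS) ρ₀) (Sum.inr v)).selmer := by
  set L := fullAtSpecification S (bigRep (κ.liftUnramifiedOutside S hS) ρ₀) (Sum.inr v) with hL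
  obtain ⟨F, hF⟩ := exists_shapiroDescent S hS κ ρ₀ ψ hψ
  -- the two dual pairs
  have h := isDualPair_datumDualData κ vbar hMtor hMstab hγ S₀ D
  have h' := isDualPair_characterModule_selmer S hS κ ρ₀ L
  -- the descent restricted to `S_𝓛`, with values in `unrSelmer κ M v̄ ∅`
  have hmem : ∀ s : L.selmer, F (s : (bigRep (κ.liftUnramifiedOutside S hS) ρ₀).H 1) ∈
      unrSelmer κ M vbar S₀ := fun s ↦
    unrSelmer_mono κ M vbar (Set.empty_subset S₀)
      (shapiroDescent_mem_unrSelmer_of_mem_fullAtSelmer S hS κ ρ₀ ψ hψ hA hF hv hne hSp s.1 s.2)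
  let φ : L.selmer →+ unrSelmer κ M vbar S₀ :=
    { toFun := fun s ↦ ⟨F s, hmem s⟩
      map_zero' := Subtype.ext (by simp)
      map_add' := fun s t ↦ Subtype.ext (by simp) }
  have hφ : ∀ s : L.selmer, φ (DistribSMul.toAddMonoidHom L.selmer (PowerSeries.X : PowerSeries ℤ_[p]) s) =
      (conjUnr κ M vbar S₀ γ - 1) (φ s) := fun s ↦ by
    apply Subtype.ext
    change F ((PowerSeries.X : PowerSeries ℤ_[p]) • (s : (bigRep (κ.liftUnramifiedOutside S hS) ρ₀).H 1)) =
      conjH1 κ.kerSubgroup M γ (F s) - F s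
    exact shapiroDescent_X_smul S hS κ ρ₀ ψ hψ hF hγ _
  have hinj : Function.Injective φ := by
    refine (injective_iff_map_eq_zero φ).2 fun s hs ↦ ?_
    have h0 : F (s : (bigRep (κ.liftUnramifiedOutside S hS) ρ₀).H 1) = 0 := congrArg Subtype.val hs
    obtain ⟨c, hc⟩ := oneCocycleClass_surjective _ (s : (bigRep (κ.liftUnramifiedOutside S hS) ρ₀).H 1)
    rw [← hc] at h0
    exact Subtype.ext (hc.symm.trans
      (oneCocycleClass_eq_zero_of_shapiroDescent_eq_zero S hS κ ρ₀ ψ hψ hA hF c h0))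
  -- functoriality of dual pairs: `D.X ↠ Hom(S_𝓛, ℚ/ℤ)`, `Λ`-linear
  obtain ⟨G, hGsurj, -⟩ := h.exists_linearMap_comp_surjective h' φ hφ hinj
  haveI : Module.Finite (PowerSeries ℤ_[p]) D.X := hDfin
  have hfin : Module.Finite (PowerSeries ℤ_[p]) (CharacterModule L.selmer) := Module.Finite.of_surjective G hGsurj
  have htor : Module.IsTorsion (PowerSeries ℤ_[p]) (CharacterModule L.selmer) := fun x ↦ by
    obtain ⟨y, rfl⟩ := hGsurj x
    obtain ⟨a, ha⟩ := @hDtor y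
    refine ⟨a, ?_⟩
    rw [Submonoid.smul_def] at ha ⊢
    rw [← map_smul, ha, map_zero]
  refine ⟨fun Y _ _ toDual hY ↦ ?_, fun Y _ _ toDual hY ↦ ?_⟩
  · let e := hY.linearEquiv (isDualPairing_characterModule (PowerSeries ℤ_[p]) L.selmer)
    haveI : Module.Finite (PowerSeries ℤ_[p]) Y := Module.Finite.equiv e.symm
    refine (Module.finrank_eq_zero_iff_isTorsion (R := PowerSeries ℤ_[p]) (M := Y)).mpr fun y ↦ ?_
    obtain ⟨a, ha⟩ := @htor (e y)
    refine ⟨a, e.injective ?_⟩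
    rw [Submonoid.smul_def] at ha ⊢
    rw [map_smul, ha, map_zero]
  · let e := hY.linearEquiv (isDualPairing_characterModule (PowerSeries ℤ_[p]) L.selmer)
    exact Module.Finite.equiv e.symm


end TransportAt

/-! ## §2 The curve: the `X_ac^{S₀}`-transport -/

section CurveTransport

variable {K : Type} [Field K] [NumberField K] (S : Set (HeightOneSpectrum (𝓞 K))) {p : ℕ} [Fact p.Prime]
  (W : WeierstrassCurve K) [W.IsElliptic]
  [TopologicalSpace (PowerSeries ℤ_[p])] [IsTopologicalRing (PowerSeries ℤ_[p])]
  [IsTopologicalAddGroup (BigRepModule ℤ_[p] p (PrimaryTorsion W.geomPoints p))]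
  [ContinuousSMul (PowerSeries ℤ_[p]) (BigRepModule ℤ_[p] p (PrimaryTorsion W.geomPoints p))]
  (hS : ∀ v : HeightOneSpectrum (𝓞 K), ((p : ℕ) : 𝓞 K) ∈ v.asIdeal → v ∈ S)
  (κ : ZpExtension K p)
  (ρ₀ : ContinuousRep (GaloisGroupUnramifiedOutside K S) ℤ_[p] (PrimaryTorsion W.geomPoints p))

/-- **`corank_Λ S_{𝓛_v}(K, 𝐃_E) = 0` and `S_{𝓛_v}(K, 𝐃_E)` cofinitely generated, FROM THE `Λ`-COTORSION OF THE
`S₀`-IMPRIMITIVE `X_ac^{S₀}(E/K_∞)`, ANY `S₀`** (the `S₀ = ∅` case is p646196 `hasCorank_fullAtSelmer_zero_of_xAc`;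
the descent lands in `Sel_v̄(K_∞, E[p^∞]) = selmerAc … ∅ ≤ selmerAc … S₀`, so the bigger dual `X_ac^{S₀}` — the one the
v20 glue `imprimLambdaT_of_index` holds as `hfgS htorS` at `S₀ = Sf` — suffices). Data: `W/K` elliptic, `K` totally complex, `v ≠ v̄` above `p` with `S ∋ v, v̄`
with `W` good at every `w ∉ S`, `w ∤ p`, a continuous `ℤ_p`-linear `ρ₀` of `G_{K,S}` on `E[p^∞]` with
`ρ₀(σ̄) P = σ • P`, a topological generator `γ` of `κ`, and Castella's `X_ac^{S₀} = XAc W p κ v̄ S₀ γ` FINITELY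
GENERATED AND TORSION. Along the injective Shapiro descent `S_{𝓛_v}(K, 𝐃_E) ↪ Sel_v̄(K_∞, E[p^∞])` (strict at
`v̄`/`S` by `loc = 0`; unramified ⟹ locally trivial at the good `w ∉ S`; no archimedean condition at complex
places), which intertwines `T` with `conj_γ − 1`, Castella's dual pair surjects `Λ`-linearly onto
`Hom(S_{𝓛_v}, ℚ/ℤ)`. This is the hypothesis `hSel` of `primaryTorsion_fullAt_SUR` / `primaryTorsion_leo_h2`.
[cite: Greenberg2006, Thm. 3 p. 342 ("as Λ-modules")] [cite: Castella2018, §2.2 Def. 2.2 (arXiv:1704.06608 p. 5)]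
[cite: GreenbergLNM1716, §1 p. 60, §3 Lemma 3.3 (p. 87)] [cite: GreenbergVatsal2000, §2 p. 17] -/
theorem hasCorank_fullAtSelmer_zero_of_xAc_at (S₀ : Set (HeightOneSpectrum (𝓞 K)))
    (hρ₀ : ∀ (σ : absoluteGaloisGroup K) (P : PrimaryTorsion W.geomPoints p),
      ρ₀ (toUnramifiedQuot K S σ) P = σ • P)
    (hKc : ∀ w : InfinitePlace K, w.IsComplex)
    {γ : absoluteGaloisGroup K} [hγ : Fact (κ.IsTopGenerator γ)]
    {v vbar : HeightOneSpectrum (𝓞 K)} (hv : ((p : ℕ) : 𝓞 K) ∈ v.asIdeal)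
    (hvbar : ((p : ℕ) : 𝓞 K) ∈ vbar.asIdeal) (hne : vbar ≠ v)
    (hgood : ∀ w : HeightOneSpectrum (𝓞 K), w ∉ S → ((p : ℕ) : 𝓞 K) ∉ w.asIdeal → W.HasGoodReductionAt w)
    (hXfin : Module.Finite (IwasawaAlgebra p) (XAc W p κ vbar S₀ γ))
    (hXtor : Module.IsTorsion (IwasawaAlgebra p) (XAc W p κ vbar S₀ γ)) :
    HasCorank (PowerSeries ℤ_[p])
        (fullAtSpecification S (bigRep (κ.liftUnramifiedOutside S hS) ρ₀) (Sum.inr v)).selmer 0 ∧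
      IsCofinitelyGenerated (PowerSeries ℤ_[p])
        (fullAtSpecification S (bigRep (κ.liftUnramifiedOutside S hS) ρ₀) (Sum.inr v)).selmer := by
  set L := fullAtSpecification S (bigRep (κ.liftUnramifiedOutside S hS) ρ₀) (Sum.inr v) with hL
  -- the model: `A = PrimaryTorsion W.geomPoints p ≃+ M = W.geomPrimaryTorsion p`, `ψ = id`
  let ψ : PrimaryTorsion W.geomPoints p ≃+ W.geomPrimaryTorsion p := AddEquiv.refl _
  have hψ : ∀ (σ : absoluteGaloisGroup K) (a : PrimaryTorsion W.geomPoints p),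
      ψ (ρ₀ (toUnramifiedQuot K S σ) a) = σ • ψ a := fun σ a ↦ by rw [hρ₀]; rfl
  have hA : ∀ a : PrimaryTorsion W.geomPoints p, ∃ k : ℕ, p ^ k • a = 0 := fun a ↦ by
    obtain ⟨k, hk⟩ := a.exists_pow_smul_eq_zero
    exact ⟨k, PrimaryTorsion.ext (by rw [PrimaryTorsion.val_nsmul]; exact hk)⟩
  have hM : ∀ m : W.geomPrimaryTorsion p, ∃ k : ℕ, p ^ k • m = 0 := fun m ↦ hA m
  have hstab : ∀ m : W.geomPrimaryTorsion p,
      IsOpen (MulAction.stabilizer (absoluteGaloisGroup K) m : Set (absoluteGaloisGroup K)) :=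
    AcSigned.isOpen_stabilizer_geomPrimaryTorsion W
  obtain ⟨F, hF⟩ := exists_shapiroDescent S hS κ ρ₀ ψ hψ
  -- the two dual pairs
  have h := XAc.isDualPair W p κ vbar S₀ γ
  have h' := isDualPair_characterModule_selmer S hS κ ρ₀ L
  -- the descent lands in Castella's `Sel_v̄(K_∞, E[p^∞])`
  have hmem : ∀ s : L.selmer, F (s : (bigRep (κ.liftUnramifiedOutside S hS) ρ₀).H 1) ∈
      selmerAc W p κ vbar S₀ := by
    rintro ⟨ξ, hξ⟩
    obtain ⟨c, rfl⟩ := oneCocycleClass_surjective _ ξ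
    rw [mem_selmer_fullAtSpecification_iff] at hξ
    have hloc : ∀ w : HeightOneSpectrum (𝓞 K), w ∈ S → w ≠ v →
        loc S (bigRep (κ.liftUnramifiedOutside S hS) ρ₀) (Sum.inr w) 1 (oneCocycleClass _ c) = 0 :=
      fun w hw hwv ↦ hξ ⟨Sum.inr w, (inSigma_inr_iff S w).mpr hw⟩ (fun e ↦ hwv (Sum.inr_injective e))
    change F (oneCocycleClass _ c) ∈ selmerOver κ.kerSubgroup (W.geomPrimaryTorsion p) p vbar S₀
    rw [mem_selmerOver_iff]
    refine ⟨fun w hpw _ σ ↦ ?_, fun w σ ↦ ?_, fun σ ↦ ?_⟩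
    · by_cases hwS : w ∈ S
      · have hwv : w ≠ v := fun e ↦ hpw (e ▸ hv)
        exact conjH1_shapiroDescent_mem_awayKer_of_loc_eq_zero S hS κ ρ₀ ψ hψ hA hF w c (hloc w hwS hwv) σ
      · -- good `w ∉ S`, `w ∤ p`: unramified ⟹ locally trivial
        have hunr := conjH1_shapiroDescent_mem_unramifiedKer_of_not_mem S hS κ ρ₀ ψ hψ hF hwS c σ
        by_cases hD : decomp (K := K) w ≤ κ.kerSubgroup
        · exact UniversalToricDescentTwistedDescent.unramifiedKer_le_awayKer_kerSubgroup_of_decomp_le W p κ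
            hpw (hgood w hwS hpw) hD hunr
        · exact UnramifiedLeAwayKer.unramifiedKer_le_awayKer_of_not_decomp_le (κ := κ) hstab hM
            (IwasawaTwoVariable.inertia_le_kerSubgroup_of_not_mem κ hpw) hD hunr
    · exact Summit.BirchSwinnertonDyer.Rank1Residual.X11b.Coinv.mem_infKer_of_decompInf_eq_bot w
        (BigGaloisRep.decompInf_eq_bot_of_isComplex (hKc w)) _
    · rw [Literature.NumberTheory.EllipticCurves.BigGaloisRep.strictKer_strictDatum_eq_awayKer]
      exact conjH1_shapiroDescent_mem_awayKer_of_loc_eq_zero S hS κ ρ₀ ψ hψ hA hF vbar c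
        (hloc vbar (hS vbar hvbar) hne) σ
  let φ : L.selmer →+ selmerAc W p κ vbar S₀ :=
    { toFun := fun s ↦ ⟨F s, hmem s⟩
      map_zero' := Subtype.ext (by simp)
      map_add' := fun s t ↦ Subtype.ext (by simp) }
  have hφ : ∀ s : L.selmer, φ (DistribSMul.toAddMonoidHom L.selmer (PowerSeries.X : PowerSeries ℤ_[p]) s) =
      (conjSelmerAc W p κ vbar S₀ γ - 1) (φ s) := fun s ↦ by
    apply Subtype.ext
    change F ((PowerSeries.X : PowerSeries ℤ_[p]) • (s : (bigRep (κ.liftUnramifiedOutside S hS) ρ₀).H 1)) =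
      W.conjH1 p κ.kerSubgroup γ (F s) - F s
    exact shapiroDescent_X_smul S hS κ ρ₀ ψ hψ hF hγ.out _
  have hinj : Function.Injective φ := by
    refine (injective_iff_map_eq_zero φ).2 fun s hs ↦ ?_
    have h0 : F (s : (bigRep (κ.liftUnramifiedOutside S hS) ρ₀).H 1) = 0 := congrArg Subtype.val hs
    obtain ⟨c, hc⟩ := oneCocycleClass_surjective _ (s : (bigRep (κ.liftUnramifiedOutside S hS) ρ₀).H 1)
    rw [← hc] at h0
    exact Subtype.ext (hc.symm.trans
      (oneCocycleClass_eq_zero_of_shapiroDescent_eq_zero S hS κ ρ₀ ψ hψ hA hF c h0))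
  -- functoriality of dual pairs: `X_ac ↠ Hom(S_𝓛, ℚ/ℤ)`, `Λ`-linear
  obtain ⟨G, hGsurj, -⟩ := h.exists_linearMap_comp_surjective h' φ hφ hinj
  haveI : Module.Finite (PowerSeries ℤ_[p]) (XAc W p κ vbar S₀ γ) := hXfin
  have hfin : Module.Finite (PowerSeries ℤ_[p]) (CharacterModule L.selmer) := Module.Finite.of_surjective G hGsurj
  have htor : Module.IsTorsion (PowerSeries ℤ_[p]) (CharacterModule L.selmer) := fun x ↦ by
    obtain ⟨y, rfl⟩ := hGsurj x
    obtain ⟨a, ha⟩ := @hXtor y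
    refine ⟨a, ?_⟩
    rw [Submonoid.smul_def] at ha ⊢
    rw [← map_smul, ha, map_zero]
  refine ⟨fun Y _ _ toDual hY ↦ ?_, fun Y _ _ toDual hY ↦ ?_⟩
  · let e := hY.linearEquiv (isDualPairing_characterModule (PowerSeries ℤ_[p]) L.selmer)
    haveI : Module.Finite (PowerSeries ℤ_[p]) Y := Module.Finite.equiv e.symm
    refine (Module.finrank_eq_zero_iff_isTorsion (R := PowerSeries ℤ_[p]) (M := Y)).mpr fun y ↦ ?_
    obtain ⟨a, ha⟩ := @htor (e y)
    refine ⟨a, e.injective ?_⟩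
    rw [Submonoid.smul_def] at ha ⊢
    rw [map_smul, ha, map_zero]
  · let e := hY.linearEquiv (isDualPairing_characterModule (PowerSeries ℤ_[p]) L.selmer)
    exact Module.Finite.equiv e.symm

end CurveTransport

end Summit.BirchSwinnertonDyer.BirchSwinnertonDyer.Theorems.AcTwistDeformation

end
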